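import Summits.HodgeConjecture.CorCM.IrreducibleOddWeightsIsotypicQuantisation
import Summits.HodgeConjecture.CorCM.IrreducibleOddWeightsShadowModulesDefect
import HarnessLib

/-!
# Isotypic cells, VI: THE DEFECT OF TYPE RANKS SPLITS OVER AN ISOTYPIC CUT, and a class of dimension-`d` constituents
# contributes a MULTIPLE of `d` — `rank Φ₀ + rank Φ₁ − rank(Φ₀,Φ₁) − 1 = Σ_classes m_τ · d_τ`

COR-CM (cell `pub-hodgecm2`, binder seat `b16` gen 70, count-neutral claim ISOTYPIC SPLITTING OF THE DEFECT, file I6 —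
abstract `G`-set level (type ranks); theorems only, no definition, no named fact, no `sorry`).  NEW as stated, hence
under `Summits/`.  HONEST FRAMING: files I4/I5 (the isotypic splitting of `S(w₀) ∩ S(w₁)` and class quantisation)
read through gen 68's SHADOW FORMULAS `rank Φ₀ + rank Φ₁ = rank(Φ₀,Φ₁) + 1 + dim(S(w₀) ∩ MC₁)` (one pivot refining
the trace classes) and `= rank(Φ₀,Φ₁) + 1 + dim(S(w₀) ∩ S(w₁))` (two pivots); the Kubota–Dodson rank of a pair of CM
types, i.e. `dim Hg(A₀)+dim Hg(A₁)−dim Hg(A₀×A₁)`; `HC_CM` is neither used nor asserted.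

* §1 **ONE-SIDED CLASS QUANTISATION** (`exists_typeRank_add_typeRank_eq_add_mul_of_class`): slot `i₀` with an
  equivariant pivot `r₀ : E_{i₀} → Y₀` refining the trace classes of the partner; if the shadow
  `w₀ = (r₀)_* u₀` lies in a sum `Σ_j A_j` of stable IRREDUCIBLE submodules of `ℚ^{Y₀}` ALL OF DIMENSION `d`, then
  for an ARBITRARY partner slot **`rank Φ₀ + rank Φ₁ = rank(Φ₀,Φ₁) + 1 + m·d`** — the defect is a multiple of `d`
  (gen 69 Q7: one constituent, `m ∈ {0,1}`).
* §2 **THE DEFECT SPLITS OVER A CUT** (`typeRank_add_typeRank_eq_add_add_of_cut`): two pivots; an isotypic cut of the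
  two shadow modules (classes `A`, `B`; no non-zero `A`-constituent embeds into a `B`-constituent); `w_κ = p_κ + q_κ`
  ⟹ **`rank Φ₀ + rank Φ₁ = rank(Φ₀,Φ₁) + 1 + dim(S(p₀) ∩ S(p₁)) + dim(S(q₀) ∩ S(q₁))`**; with both classes pure of
  dimensions `d`, `d′`: `= rank(Φ₀,Φ₁) + 1 + m·d + m′·d′` (`exists_typeRank_add_typeRank_eq_add_mul_add_mul_of_cut`).

## References

* [Gordon1999HodgeAVSurvey] B. B. Gordon, *A survey of the Hodge conjecture for abelian varieties*, §3 Theorem (proof),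
  7.5–7.7, 9.4.3.
* [Serre1977] J.-P. Serre, *Linear Representations of Finite Groups*, GTM 42, §2.6.
* [Deligne1982HodgeCycles] P. Deligne, *Hodge cycles on abelian varieties*, LNM 900, I §3 Ex. 3.7.
-/

set_option autoImplicit false

noncomputable section

open scoped BigOperators Classical

universe u u₀ u₁ u₂ u₃ v v' v'' w

namespace Summit.HodgeConjecture.CorCM.IrrOdd

open Literature.NumberTheory.ComplexMultiplication

variable {G : Type w} [Group G] {Y₀ : Type v'} [MulAction G Y₀] [Fintype Y₀]
  {Y₁ : Type v''} [MulAction G Y₁] [Fintype Y₁]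
  {I : Type u} {E : I → Type v} [∀ i, MulAction G (E i)] [∀ i, Fintype (E i)] [Fintype I] [∀ i, Nonempty (E i)]

/-! ### §1 One-sided class quantisation of the defect -/

/-- **ONE-SIDED CLASS QUANTISATION OF THE DEFECT.**  Slot `i₀` with an equivariant pivot `r₀ : E_{i₀} → Y₀` refining
the trace classes of the partner slot `i₁`; the shadow `w₀(y) = Σ_{r₀ x = y} u₀(x)` lies in a sum of stable
irreducible submodules `A_j ≤ ℚ^{Y₀}` all of dimension `d`.  Then, whatever the partner slot is,
`rank Φ₀ + rank Φ₁ = rank(Φ₀,Φ₁) + 1 + m·d` for some `m`. [cite: Gordon1999HodgeAVSurvey, §3 Theorem, 7.5–7.7 and 9.4.3]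
[cite: Serre1977, §2.6] -/
theorem exists_typeRank_add_typeRank_eq_add_mul_of_class {ρ : G} {Φ : ∀ i, Set (E i)}
    (h : ∀ i, IsCMTypeWith ρ (Φ i)) {i₀ i₁ : I} (hI : ∀ j, j = i₀ ∨ j = i₁) (h01 : i₀ ≠ i₁)
    (r₀ : E i₀ → Y₀) (hr₀ : ∀ (g : G) (x : E i₀), r₀ (g • x) = g • r₀ x)
    (hfine₀ : ∀ x x' : E i₀, r₀ x = r₀ x' → ∃ n : G, (∀ y : E i₁, n • y = y) ∧ n • x = x')
    {J₀ : Type u₀} [Fintype J₀] {A₀ : J₀ → Submodule ℚ (Y₀ → ℚ)}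
    (hA₀st : ∀ (j : J₀) (k : G) (a : Y₀ → ℚ), a ∈ A₀ j → (fun y => a (k • y)) ∈ A₀ j)
    (hA₀irr : ∀ (j : J₀) (W : Submodule ℚ (Y₀ → ℚ)), W ≤ A₀ j → W ≠ ⊥ →
      (∀ (k : G) (f : Y₀ → ℚ), f ∈ W → (fun y => f (k • y)) ∈ W) → W = A₀ j)
    {d : ℕ} (hd₀ : ∀ j, Module.finrank ℚ (A₀ j) = d)
    (hw₀ : (fun y : Y₀ => ∑ x ∈ Finset.univ.filter (fun x => r₀ x = y), antiVec (Φ i₀) (1 : G) x) ∈ ⨆ j, A₀ j) :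
    ∃ m : ℕ, typeRank G (Φ i₀) + typeRank G (Φ i₁) = typeRank G (sigmaType Φ) + 1 + m * d := by
  have hpair := typeRank_add_typeRank_eq_add_finrank_shadowCoeff_inf_of_fine h hI h01 r₀ hr₀ hfine₀
  have key := dvd_finrank_span_shadowCoeff_inf_of_class (G := G) hA₀st hA₀irr hd₀ hw₀
    (M := Submodule.span ℚ (Set.range fun x : E i₁ => fun g : G => antiVec (Φ i₁) g x))
    (fun k c hc => span_coeff_rightStable (Φ i₁) k hc)
  beta_reduce at key
  obtain ⟨m, hm⟩ := key
  refine ⟨m, ?_⟩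
  rw [hpair, hm, mul_comm]

/-! ### §2 The defect splits over an isotypic cut -/

/-- **THE DEFECT SPLITS OVER AN ISOTYPIC CUT.**  Two slots with equivariant pivots `r_κ : E_κ → Y_κ` refining the trace
classes; an isotypic cut of the shadow modules: classes `A` (`A⁰_j ≤ ℚ^{Y₀}`, `A¹_j ≤ ℚ^{Y₁}`) and `B` (`B⁰_k`, `B¹_k`)
of stable irreducible constituents, no non-zero `A`-constituent embedding equivariantly into a `B`-constituent; the
shadows decompose as `w_κ = p_κ + q_κ`, `p_κ ∈ Σ A^κ`, `q_κ ∈ Σ B^κ`.  Then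
**`rank Φ₀ + rank Φ₁ = rank(Φ₀,Φ₁) + 1 + dim(S(p₀) ∩ S(p₁)) + dim(S(q₀) ∩ S(q₁))`** — the defect is the sum of the
two class defects. [cite: Gordon1999HodgeAVSurvey, §3 Theorem, 7.5–7.7 and 9.4.3] [cite: Serre1977, §2.6] -/
theorem typeRank_add_typeRank_eq_add_add_of_cut {ρ : G} {Φ : ∀ i, Set (E i)}
    (h : ∀ i, IsCMTypeWith ρ (Φ i)) {i₀ i₁ : I} (hI : ∀ j, j = i₀ ∨ j = i₁) (h01 : i₀ ≠ i₁)
    (r₀ : E i₀ → Y₀) (r₁ : E i₁ → Y₁) (hr₀ : ∀ (g : G) (x : E i₀), r₀ (g • x) = g • r₀ x)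
    (hr₁ : ∀ (g : G) (x : E i₁), r₁ (g • x) = g • r₁ x)
    (hfine₀ : ∀ x x' : E i₀, r₀ x = r₀ x' → ∃ n : G, (∀ y : E i₁, n • y = y) ∧ n • x = x')
    (hfine₁ : ∀ x x' : E i₁, r₁ x = r₁ x' → ∃ n : G, (∀ y : E i₀, n • y = y) ∧ n • x = x')
    {J₀ : Type u₀} {J₁ : Type u₁} {K₀ : Type u₂} {K₁ : Type u₃} [Fintype J₀] [Fintype J₁] [Fintype K₀] [Fintype K₁]
    {A₀ : J₀ → Submodule ℚ (Y₀ → ℚ)} {A₁ : J₁ → Submodule ℚ (Y₁ → ℚ)}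
    {B₀ : K₀ → Submodule ℚ (Y₀ → ℚ)} {B₁ : K₁ → Submodule ℚ (Y₁ → ℚ)}
    (hA₀st : ∀ (j : J₀) (k : G) (a : Y₀ → ℚ), a ∈ A₀ j → (fun y => a (k • y)) ∈ A₀ j)
    (hA₀irr : ∀ (j : J₀) (W : Submodule ℚ (Y₀ → ℚ)), W ≤ A₀ j → W ≠ ⊥ →
      (∀ (k : G) (f : Y₀ → ℚ), f ∈ W → (fun y => f (k • y)) ∈ W) → W = A₀ j)
    (hA₁st : ∀ (j : J₁) (k : G) (a : Y₁ → ℚ), a ∈ A₁ j → (fun y => a (k • y)) ∈ A₁ j)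
    (hA₁irr : ∀ (j : J₁) (W : Submodule ℚ (Y₁ → ℚ)), W ≤ A₁ j → W ≠ ⊥ →
      (∀ (k : G) (f : Y₁ → ℚ), f ∈ W → (fun y => f (k • y)) ∈ W) → W = A₁ j)
    (hB₀st : ∀ (j : K₀) (k : G) (a : Y₀ → ℚ), a ∈ B₀ j → (fun y => a (k • y)) ∈ B₀ j)
    (hB₀irr : ∀ (j : K₀) (W : Submodule ℚ (Y₀ → ℚ)), W ≤ B₀ j → W ≠ ⊥ →
      (∀ (k : G) (f : Y₀ → ℚ), f ∈ W → (fun y => f (k • y)) ∈ W) → W = B₀ j)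
    (hB₁st : ∀ (j : K₁) (k : G) (a : Y₁ → ℚ), a ∈ B₁ j → (fun y => a (k • y)) ∈ B₁ j)
    (hB₁irr : ∀ (j : K₁) (W : Submodule ℚ (Y₁ → ℚ)), W ≤ B₁ j → W ≠ ⊥ →
      (∀ (k : G) (f : Y₁ → ℚ), f ∈ W → (fun y => f (k • y)) ∈ W) → W = B₁ j)
    (h₀₀ : ∀ (j : J₀) (k : K₀) (L : (Y₀ → ℚ) →ₗ[ℚ] (Y₀ → ℚ)), A₀ j ≠ ⊥ → (∀ a ∈ A₀ j, L a ∈ B₀ k) →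
      (∀ a ∈ A₀ j, L a = 0 → a = 0) → (∀ (g : G) (a : Y₀ → ℚ), a ∈ A₀ j →
        L (fun y => a (g • y)) = fun y => L a (g • y)) → False)
    (h₀₁ : ∀ (j : J₀) (k : K₁) (L : (Y₀ → ℚ) →ₗ[ℚ] (Y₁ → ℚ)), A₀ j ≠ ⊥ → (∀ a ∈ A₀ j, L a ∈ B₁ k) →
      (∀ a ∈ A₀ j, L a = 0 → a = 0) → (∀ (g : G) (a : Y₀ → ℚ), a ∈ A₀ j →
        L (fun y => a (g • y)) = fun y => L a (g • y)) → False)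
    (h₁₀ : ∀ (j : J₁) (k : K₀) (L : (Y₁ → ℚ) →ₗ[ℚ] (Y₀ → ℚ)), A₁ j ≠ ⊥ → (∀ a ∈ A₁ j, L a ∈ B₀ k) →
      (∀ a ∈ A₁ j, L a = 0 → a = 0) → (∀ (g : G) (a : Y₁ → ℚ), a ∈ A₁ j →
        L (fun y => a (g • y)) = fun y => L a (g • y)) → False)
    (h₁₁ : ∀ (j : J₁) (k : K₁) (L : (Y₁ → ℚ) →ₗ[ℚ] (Y₁ → ℚ)), A₁ j ≠ ⊥ → (∀ a ∈ A₁ j, L a ∈ B₁ k) →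
      (∀ a ∈ A₁ j, L a = 0 → a = 0) → (∀ (g : G) (a : Y₁ → ℚ), a ∈ A₁ j →
        L (fun y => a (g • y)) = fun y => L a (g • y)) → False)
    {p₀ q₀ : Y₀ → ℚ} {p₁ q₁ : Y₁ → ℚ} (hp₀ : p₀ ∈ ⨆ j, A₀ j) (hq₀ : q₀ ∈ ⨆ k, B₀ k)
    (hp₁ : p₁ ∈ ⨆ j, A₁ j) (hq₁ : q₁ ∈ ⨆ k, B₁ k)
    (hw₀ : (fun y : Y₀ => ∑ x ∈ Finset.univ.filter (fun x => r₀ x = y), antiVec (Φ i₀) (1 : G) x) = p₀ + q₀)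
    (hw₁ : (fun y : Y₁ => ∑ x ∈ Finset.univ.filter (fun x => r₁ x = y), antiVec (Φ i₁) (1 : G) x) = p₁ + q₁) :
    typeRank G (Φ i₀) + typeRank G (Φ i₁) = typeRank G (sigmaType Φ) + 1 +
      Module.finrank ℚ ↥(Submodule.span ℚ (Set.range fun y : Y₀ => fun g : G => p₀ (g • y)) ⊓
          Submodule.span ℚ (Set.range fun y : Y₁ => fun g : G => p₁ (g • y))) +
        Module.finrank ℚ ↥(Submodule.span ℚ (Set.range fun y : Y₀ => fun g : G => q₀ (g • y)) ⊓
          Submodule.span ℚ (Set.range fun y : Y₁ => fun g : G => q₁ (g • y))) := by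
  have hpair := typeRank_add_typeRank_eq_add_finrank_shadowCoeff_inf_shadowCoeff_of_fine h hI h01 r₀ r₁ hr₀ hr₁
    hfine₀ hfine₁
  have e₀ : (fun (y : Y₀) (g : G) => ∑ x ∈ Finset.univ.filter (fun x => r₀ x = g • y), antiVec (Φ i₀) (1 : G) x) =
      fun (y : Y₀) (g : G) => (p₀ + q₀) (g • y) := by
    funext y g
    exact congrFun hw₀ (g • y)
  have e₁ : (fun (y : Y₁) (g : G) => ∑ x ∈ Finset.univ.filter (fun x => r₁ x = g • y), antiVec (Φ i₁) (1 : G) x) =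
      fun (y : Y₁) (g : G) => (p₁ + q₁) (g • y) := by
    funext y g
    exact congrFun hw₁ (g • y)
  rw [e₀, e₁, finrank_span_shadowCoeff_inf_eq_add_of_cut hA₀st hA₀irr hA₁st hA₁irr hB₀st hB₀irr hB₁st hB₁irr
    h₀₀ h₀₁ h₁₀ h₁₁ hp₀ hq₀ hp₁ hq₁, ← add_assoc] at hpair
  exact hpair

/-- **BOTH CLASSES PURE**: if moreover every `A`-constituent has dimension `d` and every `B`-constituent dimension `d′`,
then `rank Φ₀ + rank Φ₁ = rank(Φ₀,Φ₁) + 1 + m·d + m′·d′`. [cite: Gordon1999HodgeAVSurvey, §3 Theorem, 7.5–7.7]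
[cite: Serre1977, §2.6] -/
theorem exists_typeRank_add_typeRank_eq_add_mul_add_mul_of_cut {ρ : G} {Φ : ∀ i, Set (E i)}
    (h : ∀ i, IsCMTypeWith ρ (Φ i)) {i₀ i₁ : I} (hI : ∀ j, j = i₀ ∨ j = i₁) (h01 : i₀ ≠ i₁)
    (r₀ : E i₀ → Y₀) (r₁ : E i₁ → Y₁) (hr₀ : ∀ (g : G) (x : E i₀), r₀ (g • x) = g • r₀ x)
    (hr₁ : ∀ (g : G) (x : E i₁), r₁ (g • x) = g • r₁ x)
    (hfine₀ : ∀ x x' : E i₀, r₀ x = r₀ x' → ∃ n : G, (∀ y : E i₁, n • y = y) ∧ n • x = x')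
    (hfine₁ : ∀ x x' : E i₁, r₁ x = r₁ x' → ∃ n : G, (∀ y : E i₀, n • y = y) ∧ n • x = x')
    {J₀ : Type u₀} {J₁ : Type u₁} {K₀ : Type u₂} {K₁ : Type u₃} [Fintype J₀] [Fintype J₁] [Fintype K₀] [Fintype K₁]
    {A₀ : J₀ → Submodule ℚ (Y₀ → ℚ)} {A₁ : J₁ → Submodule ℚ (Y₁ → ℚ)}
    {B₀ : K₀ → Submodule ℚ (Y₀ → ℚ)} {B₁ : K₁ → Submodule ℚ (Y₁ → ℚ)}
    (hA₀st : ∀ (j : J₀) (k : G) (a : Y₀ → ℚ), a ∈ A₀ j → (fun y => a (k • y)) ∈ A₀ j)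
    (hA₀irr : ∀ (j : J₀) (W : Submodule ℚ (Y₀ → ℚ)), W ≤ A₀ j → W ≠ ⊥ →
      (∀ (k : G) (f : Y₀ → ℚ), f ∈ W → (fun y => f (k • y)) ∈ W) → W = A₀ j)
    (hA₁st : ∀ (j : J₁) (k : G) (a : Y₁ → ℚ), a ∈ A₁ j → (fun y => a (k • y)) ∈ A₁ j)
    (hA₁irr : ∀ (j : J₁) (W : Submodule ℚ (Y₁ → ℚ)), W ≤ A₁ j → W ≠ ⊥ →
      (∀ (k : G) (f : Y₁ → ℚ), f ∈ W → (fun y => f (k • y)) ∈ W) → W = A₁ j)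
    (hB₀st : ∀ (j : K₀) (k : G) (a : Y₀ → ℚ), a ∈ B₀ j → (fun y => a (k • y)) ∈ B₀ j)
    (hB₀irr : ∀ (j : K₀) (W : Submodule ℚ (Y₀ → ℚ)), W ≤ B₀ j → W ≠ ⊥ →
      (∀ (k : G) (f : Y₀ → ℚ), f ∈ W → (fun y => f (k • y)) ∈ W) → W = B₀ j)
    (hB₁st : ∀ (j : K₁) (k : G) (a : Y₁ → ℚ), a ∈ B₁ j → (fun y => a (k • y)) ∈ B₁ j)
    (hB₁irr : ∀ (j : K₁) (W : Submodule ℚ (Y₁ → ℚ)), W ≤ B₁ j → W ≠ ⊥ →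
      (∀ (k : G) (f : Y₁ → ℚ), f ∈ W → (fun y => f (k • y)) ∈ W) → W = B₁ j)
    (h₀₀ : ∀ (j : J₀) (k : K₀) (L : (Y₀ → ℚ) →ₗ[ℚ] (Y₀ → ℚ)), A₀ j ≠ ⊥ → (∀ a ∈ A₀ j, L a ∈ B₀ k) →
      (∀ a ∈ A₀ j, L a = 0 → a = 0) → (∀ (g : G) (a : Y₀ → ℚ), a ∈ A₀ j →
        L (fun y => a (g • y)) = fun y => L a (g • y)) → False)
    (h₀₁ : ∀ (j : J₀) (k : K₁) (L : (Y₀ → ℚ) →ₗ[ℚ] (Y₁ → ℚ)), A₀ j ≠ ⊥ → (∀ a ∈ A₀ j, L a ∈ B₁ k) →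
      (∀ a ∈ A₀ j, L a = 0 → a = 0) → (∀ (g : G) (a : Y₀ → ℚ), a ∈ A₀ j →
        L (fun y => a (g • y)) = fun y => L a (g • y)) → False)
    (h₁₀ : ∀ (j : J₁) (k : K₀) (L : (Y₁ → ℚ) →ₗ[ℚ] (Y₀ → ℚ)), A₁ j ≠ ⊥ → (∀ a ∈ A₁ j, L a ∈ B₀ k) →
      (∀ a ∈ A₁ j, L a = 0 → a = 0) → (∀ (g : G) (a : Y₁ → ℚ), a ∈ A₁ j →
        L (fun y => a (g • y)) = fun y => L a (g • y)) → False)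
    (h₁₁ : ∀ (j : J₁) (k : K₁) (L : (Y₁ → ℚ) →ₗ[ℚ] (Y₁ → ℚ)), A₁ j ≠ ⊥ → (∀ a ∈ A₁ j, L a ∈ B₁ k) →
      (∀ a ∈ A₁ j, L a = 0 → a = 0) → (∀ (g : G) (a : Y₁ → ℚ), a ∈ A₁ j →
        L (fun y => a (g • y)) = fun y => L a (g • y)) → False)
    {d d' : ℕ} (hd₀ : ∀ j, Module.finrank ℚ (A₀ j) = d) (hd' : ∀ k, Module.finrank ℚ (B₀ k) = d')
    {p₀ q₀ : Y₀ → ℚ} {p₁ q₁ : Y₁ → ℚ} (hp₀ : p₀ ∈ ⨆ j, A₀ j) (hq₀ : q₀ ∈ ⨆ k, B₀ k)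
    (hp₁ : p₁ ∈ ⨆ j, A₁ j) (hq₁ : q₁ ∈ ⨆ k, B₁ k)
    (hw₀ : (fun y : Y₀ => ∑ x ∈ Finset.univ.filter (fun x => r₀ x = y), antiVec (Φ i₀) (1 : G) x) = p₀ + q₀)
    (hw₁ : (fun y : Y₁ => ∑ x ∈ Finset.univ.filter (fun x => r₁ x = y), antiVec (Φ i₁) (1 : G) x) = p₁ + q₁) :
    ∃ m m' : ℕ, typeRank G (Φ i₀) + typeRank G (Φ i₁) = typeRank G (sigmaType Φ) + 1 + m * d + m' * d' := by
  have hsplit := typeRank_add_typeRank_eq_add_add_of_cut h hI h01 r₀ r₁ hr₀ hr₁ hfine₀ hfine₁ hA₀st hA₀irr hA₁st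
    hA₁irr hB₀st hB₀irr hB₁st hB₁irr h₀₀ h₀₁ h₁₀ h₁₁ hp₀ hq₀ hp₁ hq₁ hw₀ hw₁
  obtain ⟨m, hm⟩ := dvd_finrank_span_shadowCoeff_inf_span_shadowCoeff_of_class hA₀st hA₀irr hd₀ hp₀ p₁
  obtain ⟨m', hm'⟩ := dvd_finrank_span_shadowCoeff_inf_span_shadowCoeff_of_class hB₀st hB₀irr hd' hq₀ q₁
  refine ⟨m, m', ?_⟩
  rw [hsplit, hm, hm', mul_comm d m, mul_comm d' m']

end Summit.HodgeConjecture.CorCM.IrrOdd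

end
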